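import Literature.Topology.FourManifolds.TubeReparam
import Literature.Topology.FourManifolds.FibreStraightening
import HarnessLib

/-!
# Linear reframings of the tube of a circle surgery

Generic four-manifold infrastructure for the well-definedness of surgery on a framed circle
(Gompf–Stipsicz, *4-Manifolds and Kirby Calculus*, §5.2: the surgered manifold only depends on the
framed circle up to isotopy, and on the framing only through its homotopy class). Given a tubular
neighbourhood `ν : 𝕊¹ × ℝ³ ↪ X` of a circle `c` and a smooth loop `L : 𝕊¹ → GL(3, ℝ)` of
invertible operators (`Literature.Topology.FourManifolds.OpLoop`), the **linearly reframed tube**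
`ν.linTwist L : (u, w) ↦ ν (u, L_u w)` is again a tubular neighbourhood of `c`
(`Literature.Topology.FourManifolds.CircleNbhd.linTwist`). We prove:

* `Literature.Topology.FourManifolds.CircleNbhd.nonempty_diffeomorph_surgered_linTwist_of_close` — if two loops are uniformly
  close, `‖L_u⁻¹ L'_u - 1‖ < straightenThreshold`, the surgeries along `ν.linTwist L` and
  `ν.linTwist L'` are diffeomorphic: the compactly supported straightenings
  `G_u = straightenFun (L_u⁻¹ L'_u)` (`FibreStraightening`) at scale `1/3` are *equal* to
  `L_u⁻¹ L'_u` on the unit ball, so `ν.linTwist L ∘ (u, w) ↦ (u, G_u w)` agrees with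
  `ν.linTwist L'` on the unit ball bundle, and `TubeReparam` applies;
* `Literature.Topology.FourManifolds.CircleNbhd.nonempty_diffeomorph_surgered_linTwist_of_family` — the same for the two ends
  of a family `t ↦ L_t` of smooth loops depending continuously on `t ∈ [0, 1]` (uniform continuity
  on the compact `[0, 1] × 𝕊¹` cuts the family into finitely many close steps);
* small generic pieces: `Literature.Topology.FourManifolds.TubeDiffeo.ofFibre` (a compactly supported diffeomorphism of `ℝ³`
  fixing `0`, used fibrewise), `Literature.Topology.FourManifolds.CircleNbhd.reparam` (precomposing a tube with a diffeomorphism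
  of `𝕊¹ × ℝ³` fixing the zero section).

## References
* R. E. Gompf, A. I. Stipsicz, *4-Manifolds and Kirby Calculus*, GSM 20 (1999), §5.2.
* M. W. Hirsch, *Differential Topology* (1976), Ch. 8 §3 (inserting a bump function).
-/

noncomputable section

open scoped Manifold ContDiff Topology
open Set Function Metric

universe u

namespace Literature.Topology.FourManifolds

/-- Local notation: `𝔼 n` is the model Euclidean space `EuclideanSpace ℝ (Fin n)`. -/
local notation "𝔼 " n:arg => EuclideanSpace ℝ (Fin n)

/-- Local notation: `𝕊 n` is the unit sphere in `EuclideanSpace ℝ (Fin (n + 1))`. -/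
local notation "𝕊 " n:arg => (Metric.sphere (0 : EuclideanSpace ℝ (Fin (n + 1))) 1 : Set _)

/-! ### Smooth loops of invertible operators -/

/-- **A smooth loop of invertible operators on `ℝ³`** (a smooth automorphism of the trivial
rank-`3` bundle over `𝕊¹`, i.e. a change of trivialisation of the normal bundle of a circle),
given with its smooth pointwise inverse. [cite: GompfStipsiczGSM1999, §5.2] -/
structure OpLoop where
  /-- The operators. -/
  toFun : 𝕊 1 → (𝔼 3 →L[ℝ] 𝔼 3)
  /-- The pointwise inverses. -/
  inv : 𝕊 1 → (𝔼 3 →L[ℝ] 𝔼 3)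
  /-- The operators depend smoothly on the point of the circle. -/
  contMDiff_toFun : ContMDiff (𝓡 1) 𝓘(ℝ, 𝔼 3 →L[ℝ] 𝔼 3) ∞ toFun
  /-- The inverses depend smoothly on the point of the circle. -/
  contMDiff_inv : ContMDiff (𝓡 1) 𝓘(ℝ, 𝔼 3 →L[ℝ] 𝔼 3) ∞ inv
  /-- `inv u` is a right inverse. -/
  mul_inv : ∀ u, toFun u * inv u = 1
  /-- `inv u` is a left inverse. -/
  inv_mul : ∀ u, inv u * toFun u = 1

namespace OpLoop

variable (L : OpLoop)

/-- `L_u⁻¹ (L_u w) = w`. [folklore] -/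
@[simp] theorem inv_apply_apply (u : 𝕊 1) (w : 𝔼 3) : L.inv u (L.toFun u w) = w := by
  have h := congrArg (fun T : 𝔼 3 →L[ℝ] 𝔼 3 ↦ T w) (L.inv_mul u)
  exact h

/-- `L_u (L_u⁻¹ w) = w`. [folklore] -/
@[simp] theorem apply_inv_apply (u : 𝕊 1) (w : 𝔼 3) : L.toFun u (L.inv u w) = w := by
  have h := congrArg (fun T : 𝔼 3 →L[ℝ] 𝔼 3 ↦ T w) (L.mul_inv u)
  exact h

/-- The constant loop at the identity. [folklore] -/
def one : OpLoop where
  toFun _ := 1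
  inv _ := 1
  contMDiff_toFun := contMDiff_const
  contMDiff_inv := contMDiff_const
  mul_inv _ := mul_one _
  inv_mul _ := mul_one _

/-- `(u, w) ↦ L_u w` is smooth on `𝕊¹ × ℝ³`. [folklore] -/
theorem contMDiff_apply : ContMDiff ((𝓡 1).prod 𝓘(ℝ, 𝔼 3)) 𝓘(ℝ, 𝔼 3) ∞
    fun p : (𝕊 1) × 𝔼 3 ↦ L.toFun p.1 p.2 :=
  (isBoundedBilinearMap_apply.contDiff (n := ∞)).comp_contMDiff
    ((L.contMDiff_toFun.comp contMDiff_fst).prodMk_space contMDiff_snd)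

/-- `(u, w) ↦ L_u⁻¹ w` is smooth on `𝕊¹ × ℝ³`. [folklore] -/
theorem contMDiff_inv_apply : ContMDiff ((𝓡 1).prod 𝓘(ℝ, 𝔼 3)) 𝓘(ℝ, 𝔼 3) ∞
    fun p : (𝕊 1) × 𝔼 3 ↦ L.inv p.1 p.2 :=
  (isBoundedBilinearMap_apply.contDiff (n := ∞)).comp_contMDiff
    ((L.contMDiff_inv.comp contMDiff_fst).prodMk_space contMDiff_snd)

/-- **The bundle automorphism `(u, w) ↦ (u, L_u w)` of `𝕊¹ × ℝ³`.** [cite: GompfStipsiczGSM1999, §5.2] -/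
def prodDiffeo : ((𝕊 1) × 𝔼 3) ≃ₘ⟮(𝓡 1).prod 𝓘(ℝ, 𝔼 3), (𝓡 1).prod 𝓘(ℝ, 𝔼 3)⟯ ((𝕊 1) × 𝔼 3) where
  toFun p := (p.1, L.toFun p.1 p.2)
  invFun p := (p.1, L.inv p.1 p.2)
  left_inv p := Prod.ext rfl (L.inv_apply_apply p.1 p.2)
  right_inv p := Prod.ext rfl (L.apply_inv_apply p.1 p.2)
  contMDiff_toFun := contMDiff_fst.prodMk L.contMDiff_apply
  contMDiff_invFun := contMDiff_fst.prodMk L.contMDiff_inv_apply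

/-- The bundle automorphism, pointwise. [folklore] -/
@[simp] theorem prodDiffeo_apply (p : (𝕊 1) × 𝔼 3) : L.prodDiffeo p = (p.1, L.toFun p.1 p.2) := rfl

end OpLoop

/-! ### Tube reparametrisations that are constant along the circle -/

/-- **A fibre diffeomorphism as a `TubeDiffeo`**: `(u, w) ↦ (u, g w)` for a diffeomorphism `g` of
`ℝ³` fixing `0` and equal to the identity off `B(0, R)`. [cite: GompfStipsiczGSM1999, §5.2] -/
def TubeDiffeo.ofFibre (g : 𝔼 3 ≃ₘ⟮𝓘(ℝ, 𝔼 3), 𝓘(ℝ, 𝔼 3)⟯ 𝔼 3) (R : ℝ) (h0 : g 0 = 0)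
    (hR : ∀ w, R ≤ ‖w‖ → g w = w) : TubeDiffeo where
  toDiffeomorph := (Diffeomorph.refl (𝓡 1) (𝕊 1) ∞).prodCongr g
  radius := R
  apply_zero u := by
    rw [Diffeomorph.coe_prodCongr, Diffeomorph.coe_refl]
    exact Prod.ext rfl h0
  eq_self p hp := by
    rw [Diffeomorph.coe_prodCongr, Diffeomorph.coe_refl]
    exact Prod.ext rfl (hR p.2 hp)

/-- The fibre reparametrisation, pointwise. [folklore] -/
@[simp] theorem TubeDiffeo.ofFibre_apply (g : 𝔼 3 ≃ₘ⟮𝓘(ℝ, 𝔼 3), 𝓘(ℝ, 𝔼 3)⟯ 𝔼 3) (R : ℝ)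
    (h0 : g 0 = 0) (hR : ∀ w, R ≤ ‖w‖ → g w = w) (u : 𝕊 1) (w : 𝔼 3) :
    (TubeDiffeo.ofFibre g R h0 hR).toDiffeomorph (u, w) = (u, g w) := by
  show ((Diffeomorph.refl (𝓡 1) (𝕊 1) ∞).prodCongr g) (u, w) = (u, g w)
  rw [Diffeomorph.coe_prodCongr, Diffeomorph.coe_refl]
  rfl

/-! ### Reparametrised tubes -/

namespace CircleNbhd

variable {X : Type u} [TopologicalSpace X] [ChartedSpace (𝔼 4) X] {c : 𝕊 1 → X}
  (ν : CircleNbhd (𝓡 4) c)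

/-- **Precomposing a tube with a diffeomorphism of `𝕊¹ × ℝ³` fixing the zero section pointwise**
gives a tube of the same circle. [cite: GompfStipsiczGSM1999, §5.2] -/
def reparam (G : ((𝕊 1) × 𝔼 3) ≃ₘ⟮(𝓡 1).prod 𝓘(ℝ, 𝔼 3), (𝓡 1).prod 𝓘(ℝ, 𝔼 3)⟯ ((𝕊 1) × 𝔼 3))
    (hG : ∀ u, G (u, 0) = (u, 0)) : CircleNbhd (𝓡 4) c where
  toFun := ν.toFun ∘ G
  isSmoothEmbedding := ν.isSmoothEmbedding.comp_diffeomorph G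
  isOpen_range := by
    have hs : Surjective (fun p ↦ G p) := G.surjective
    rw [Set.range_comp, hs.range_eq, image_univ]
    exact ν.isOpen_range
  apply_zero u := by rw [comp_apply, hG, ν.apply_zero]

/-- The reparametrised tube, pointwise. [folklore] -/
@[simp] theorem reparam_apply
    (G : ((𝕊 1) × 𝔼 3) ≃ₘ⟮(𝓡 1).prod 𝓘(ℝ, 𝔼 3), (𝓡 1).prod 𝓘(ℝ, 𝔼 3)⟯ ((𝕊 1) × 𝔼 3))
    (hG : ∀ u, G (u, 0) = (u, 0)) (p : (𝕊 1) × 𝔼 3) : (ν.reparam G hG).toFun p = ν.toFun (G p) :=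
  rfl

/-- **The linearly reframed tube `(u, w) ↦ ν (u, L_u w)`** of a smooth loop of invertible
operators: the same tubular neighbourhood with another trivialisation of the normal bundle. [cite: GompfStipsiczGSM1999, §5.2] -/
def linTwist (L : OpLoop) : CircleNbhd (𝓡 4) c :=
  ν.reparam L.prodDiffeo fun _ ↦ Prod.ext rfl (map_zero _)

/-- The linearly reframed tube, pointwise. [folklore] -/
@[simp] theorem linTwist_apply (L : OpLoop) (u : 𝕊 1) (w : 𝔼 3) :
    (ν.linTwist L).toFun (u, w) = ν.toFun (u, L.toFun u w) := rfl

/-- Reframing by the identity loop does nothing. [folklore] -/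
theorem linTwist_one_apply (p : (𝕊 1) × 𝔼 3) : (ν.linTwist OpLoop.one).toFun p = ν.toFun p := rfl

end CircleNbhd

/-! ### The step: uniformly close loops -/

section Step

/-- The straightening threshold of `FibreStraightening` for the bump `coreBump` on `ℝ³`. [folklore] -/
abbrev linThreshold : ℝ := straightenThreshold (coreBump (E := 𝔼 3))

/-- The threshold is positive. [folklore] -/
theorem linThreshold_pos : 0 < linThreshold := straightenThreshold_pos _

variable (L L' : OpLoop)

/-- The transition operators `M_u := L_u⁻¹ L'_u`. [folklore] -/
def transitionOp (u : 𝕊 1) : 𝔼 3 →L[ℝ] 𝔼 3 := L.inv u * L'.toFun u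

/-- `L_u (M_u w) = L'_u w`. [folklore] -/
theorem apply_transitionOp (u : 𝕊 1) (w : 𝔼 3) : L.toFun u (transitionOp L L' u w) = L'.toFun u w := by
  show L.toFun u (L.inv u (L'.toFun u w)) = L'.toFun u w
  rw [L.apply_inv_apply]

/-- The transition operators depend smoothly on `u`. [folklore] -/
theorem contMDiff_transitionOp : ContMDiff (𝓡 1) 𝓘(ℝ, 𝔼 3 →L[ℝ] 𝔼 3) ∞ (transitionOp L L') :=
  (contDiff_mul (𝔸 := 𝔼 3 →L[ℝ] 𝔼 3) (n := ∞)).comp_contMDiff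
    (L.contMDiff_inv.prodMk_space L'.contMDiff_toFun)

/-- **The fibre maps of the step**: `G_u := straightenFun (1/3) M_u`, equal to `M_u` on the unit
ball and to the identity off `B(0, 17/15)`. [cite: Hirsch1976, Ch. 8 §3, proof of Thm 3.1 (inserting a bump function)] -/
def stepFibre (u : 𝕊 1) (w : 𝔼 3) : 𝔼 3 := straightenFun coreBump (1 / 3) (transitionOp L L' u) w

/-- On the unit ball the fibre map is `M_u`. [folklore] -/
theorem stepFibre_of_norm_le (u : 𝕊 1) {w : 𝔼 3} (hw : ‖w‖ ≤ 1) :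
    stepFibre L L' u w = transitionOp L L' u w :=
  straightenFun_of_norm_le _ (by norm_num) _ (by show ‖w‖ ≤ 1 / 3 * 3; linarith)

/-- Off `B(0, 17/15)` the fibre map is the identity. [folklore] -/
theorem stepFibre_of_le_norm (u : 𝕊 1) {w : 𝔼 3} (hw : 17 / 15 ≤ ‖w‖) : stepFibre L L' u w = w :=
  straightenFun_of_le_norm _ (by norm_num) _ (by show 1 / 3 * (17 / 5) ≤ ‖w‖; linarith)

/-- The fibre maps fix `0`. [folklore] -/
@[simp] theorem stepFibre_apply_zero (u : 𝕊 1) : stepFibre L L' u 0 = 0 :=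
  straightenFun_apply_zero _ _ _

/-- The fibre maps are jointly smooth. [folklore] -/
theorem contMDiff_stepFibre :
    ContMDiff ((𝓡 1).prod 𝓘(ℝ, 𝔼 3)) 𝓘(ℝ, 𝔼 3) ∞ (uncurry (stepFibre L L')) := by
  have h1 : ContMDiff ((𝓡 1).prod 𝓘(ℝ, 𝔼 3)) 𝓘(ℝ, (𝔼 3 →L[ℝ] 𝔼 3) × 𝔼 3) ∞
      fun p : (𝕊 1) × 𝔼 3 ↦ (transitionOp L L' p.1, p.2) :=
    ((contMDiff_transitionOp L L').comp contMDiff_fst).prodMk_space contMDiff_snd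
  have h2 := (contDiff_straightenFun_uncurry (coreBump (E := 𝔼 3)) (1 / 3)).comp_contMDiff h1
  exact h2

variable {L L'}

/-- **The tube reparametrisation of the step** `(u, w) ↦ (u, G_u w)` (for close loops each
`G_u` is a diffeomorphism, `straightenDiffeo`). [cite: GompfStipsiczGSM1999, §5.2] -/
def stepTubeDiffeo (h : ∀ u, ‖transitionOp L L' u - 1‖ < linThreshold) : TubeDiffeo where
  toDiffeomorph := fibrewiseDiffeomorph (contMDiff_stepFibre L L')
    (fun u ↦ (straightenDiffeo coreBump (by norm_num : (0 : ℝ) < 1 / 3) (transitionOp L L' u)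
      (h u).le).isLocalDiffeomorph)
    (fun u ↦ (straightenDiffeo coreBump (by norm_num : (0 : ℝ) < 1 / 3) (transitionOp L L' u)
      (h u).le).bijective)
  radius := 17 / 15
  apply_zero u := by
    rw [coe_fibrewiseDiffeomorph, fibrewiseFun_apply, stepFibre_apply_zero]
  eq_self p hp := by
    rw [coe_fibrewiseDiffeomorph]
    exact Prod.ext rfl (stepFibre_of_le_norm L L' p.1 hp)

/-- The step reparametrisation, pointwise. [folklore] -/
@[simp] theorem stepTubeDiffeo_apply (h : ∀ u, ‖transitionOp L L' u - 1‖ < linThreshold)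
    (u : 𝕊 1) (w : 𝔼 3) : (stepTubeDiffeo h).toDiffeomorph (u, w) = (u, stepFibre L L' u w) := rfl

variable {X : Type u} [TopologicalSpace X] [ChartedSpace (𝔼 4) X] [T2Space X]
  [IsManifold (𝓡 4) ∞ X] {c : 𝕊 1 → X}

/-- **The step: uniformly close linear reframings give diffeomorphic surgeries.** If
`‖L_u⁻¹ L'_u - 1‖ < linThreshold` for all `u`, then
`(ν.linTwist L).Surgered ≃ₘ (ν.linTwist L').Surgered`. [cite: GompfStipsiczGSM1999, §5.2] -/
theorem CircleNbhd.nonempty_diffeomorph_surgered_linTwist_of_close (ν : CircleNbhd (𝓡 4) c)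
    (h : ∀ u, ‖transitionOp L L' u - 1‖ < linThreshold) :
    Nonempty ((ν.linTwist L).Surgered ≃ₘ⟮𝓡 4, 𝓡 4⟯ (ν.linTwist L').Surgered) := by
  refine (ν.linTwist L).nonempty_diffeomorph_surgered_of_eqOn_twist (stepTubeDiffeo h)
    (ν.linTwist L') fun u w hw ↦ ?_
  rw [stepTubeDiffeo_apply, CircleNbhd.linTwist_apply, CircleNbhd.linTwist_apply,
    stepFibre_of_norm_le L L' u hw.le, apply_transitionOp]

end Step

/-! ### Families of loops depending continuously on a parameter -/

section Family

variable {X : Type u} [TopologicalSpace X] [ChartedSpace (𝔼 4) X] [T2Space X]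
  [IsManifold (𝓡 4) ∞ X] {c : 𝕊 1 → X}

/-- Close operators in operator norm give close transition operators:
`‖L⁻¹ L' - 1‖ ≤ ‖L⁻¹‖ ‖L' - L‖`. [folklore] -/
theorem norm_transitionOp_sub_one_le (L L' : OpLoop) (u : 𝕊 1) :
    ‖transitionOp L L' u - 1‖ ≤ ‖L.inv u‖ * ‖L'.toFun u - L.toFun u‖ := by
  have h1 : transitionOp L L' u - 1 = L.inv u * (L'.toFun u - L.toFun u) := by
    rw [transitionOp, mul_sub, L.inv_mul]
  rw [h1]
  exact norm_mul_le _ _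

/-- **The two ends of a continuous family of smooth loops give diffeomorphic surgeries.** For
`t ↦ L_t` with `(t, u) ↦ L_t u` and `(t, u) ↦ L_t u⁻¹` continuous on `[0, 1] × 𝕊¹`,
`(ν.linTwist L₀).Surgered ≃ₘ (ν.linTwist L₁).Surgered`: by uniform continuity on the compact
`[0, 1] × 𝕊¹` consecutive loops of a fine partition are uniformly close, and the steps compose. [cite: GompfStipsiczGSM1999, §5.2] -/
theorem CircleNbhd.nonempty_diffeomorph_surgered_linTwist_of_family (ν : CircleNbhd (𝓡 4) c)
    (F : ℝ → OpLoop)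
    (hF : ContinuousOn (fun p : ℝ × (𝕊 1) ↦ (F p.1).toFun p.2) (Icc 0 1 ×ˢ univ))
    (hFi : ContinuousOn (fun p : ℝ × (𝕊 1) ↦ (F p.1).inv p.2) (Icc 0 1 ×ˢ univ)) :
    Nonempty ((ν.linTwist (F 0)).Surgered ≃ₘ⟮𝓡 4, 𝓡 4⟯ (ν.linTwist (F 1)).Surgered) := by
  have hS : IsCompact (Icc (0 : ℝ) 1 ×ˢ (univ : Set (𝕊 1))) := isCompact_Icc.prod isCompact_univ
  -- a bound for the inverses
  obtain ⟨K, hK⟩ := hS.exists_bound_of_continuousOn hFi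
  set K' : ℝ := max K 1 with hK'
  have hK'pos : 0 < K' := lt_of_lt_of_le one_pos (le_max_right _ _)
  have hKle : ∀ t ∈ Icc (0 : ℝ) 1, ∀ u, ‖(F t).inv u‖ ≤ K' := fun t ht u ↦
    (hK (t, u) ⟨ht, mem_univ _⟩).trans (le_max_left _ _)
  -- uniform continuity of the operators
  obtain ⟨δ, hδ, hδF⟩ := Metric.uniformContinuousOn_iff.1 (hS.uniformContinuousOn_of_continuous hF)
    (linThreshold / (2 * K')) (div_pos linThreshold_pos (by positivity))
  have hclose : ∀ t ∈ Icc (0 : ℝ) 1, ∀ t' ∈ Icc (0 : ℝ) 1, dist t t' < δ →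
      ∀ u, ‖transitionOp (F t) (F t') u - 1‖ < linThreshold := by
    intro t ht t' ht' hd u
    have h1 : dist ((F t).toFun u) ((F t').toFun u) < linThreshold / (2 * K') := by
      refine hδF (t, u) ⟨ht, mem_univ _⟩ (t', u) ⟨ht', mem_univ _⟩ ?_
      rw [Prod.dist_eq, dist_self]
      exact max_lt hd hδ
    rw [dist_eq_norm, ← norm_neg, neg_sub] at h1
    calc ‖transitionOp (F t) (F t') u - 1‖ ≤ ‖(F t).inv u‖ * ‖(F t').toFun u - (F t).toFun u‖ :=
          norm_transitionOp_sub_one_le _ _ u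
      _ ≤ K' * (linThreshold / (2 * K')) := mul_le_mul (hKle t ht u) h1.le (norm_nonneg _) hK'pos.le
      _ = linThreshold / 2 := by field_simp
      _ < linThreshold := by linarith [linThreshold_pos]
  -- the partition
  obtain ⟨n, hn⟩ := exists_nat_one_div_lt hδ
  set N : ℝ := (n : ℝ) + 1 with hN
  have hNpos : 0 < N := by positivity
  set node : ℕ → ℝ := fun i ↦ (i : ℝ) / N with hnode
  have hnode_mem : ∀ i, i ≤ n + 1 → node i ∈ Icc (0 : ℝ) 1 := fun i hi ↦ by
    refine ⟨div_nonneg (Nat.cast_nonneg _) hNpos.le, ?_⟩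
    rw [hnode]
    dsimp only
    rw [div_le_one hNpos, hN]
    exact_mod_cast hi
  have hnode_dist : ∀ i, dist (node i) (node (i + 1)) < δ := fun i ↦ by
    have h1 : node (i + 1) - node i = 1 / N := by
      rw [hnode]
      dsimp only
      rw [div_sub_div_same, Nat.cast_succ, add_sub_cancel_left]
    rw [dist_comm, Real.dist_eq, h1, abs_of_pos (by positivity)]
    exact hn
  -- induction along the nodes
  have key : ∀ i, i ≤ n + 1 →
      Nonempty ((ν.linTwist (F 0)).Surgered ≃ₘ⟮𝓡 4, 𝓡 4⟯ (ν.linTwist (F (node i))).Surgered) := by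
    intro i
    induction i with
    | zero =>
      intro _
      have h0 : node 0 = 0 := by rw [hnode]; dsimp only; rw [Nat.cast_zero, zero_div]
      rw [h0]
      exact ⟨Diffeomorph.refl _ _ _⟩
    | succ i ih =>
      intro hi
      obtain ⟨e⟩ := ih (by omega)
      obtain ⟨e'⟩ := ν.nonempty_diffeomorph_surgered_linTwist_of_close
        (hclose _ (hnode_mem i (by omega)) _ (hnode_mem (i + 1) hi) (hnode_dist i))
      exact ⟨e.trans e'⟩
  have h1 : node (n + 1) = 1 := by
    rw [hnode]
    dsimp only
    rw [show ((n + 1 : ℕ) : ℝ) = N by rw [hN]; push_cast; rfl, div_self hNpos.ne']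
  have h2 := key (n + 1) le_rfl
  rwa [h1] at h2

end Family

end Literature.Topology.FourManifolds
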